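import Literature.MathematicalPhysics.QuantumFieldTheory.Balaban1983to89.T4HistoryLipschitzSegment
import Summits.QuantumFields.BalabanUV.T4Continuum.Support.NE9ComplexEncoding

/-!
# NE9ChartFamilyPullback — the REAL row of NE9 read from a FAMILY of complex charts, one chart per real background, each read
# at its own CENTRE: `NE9` ∕ `TermSize` ∕ `DecayBound` pull back along chart families (no logarithm, no global chart)
# (cell `pub-balaban`, T4-DAG §2 node U3 ∕ §6 NE9; BINDER row NE9 OWNER lineage `b2b-balaban-t4-ne9-p1`, generation 31 —
# kernel premise of the owner's answer to the substrate's D-8 questions, journal l.14382 ∕ sheet `t4/b2b-balaban-t4-ne9-p1/g31/D8-ANSWER-NE9-g31.md`)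

HONEST FRAMING (T4-DAG PAGE 1).  Rung (B)+1 of the FINITE-VOLUME T⁴ programme — NOT infinite volume, NOT a mass gap, NOT the
Clay problem.  NE9 (`T4OutputRate.NE9` ∧ `FadingMemory`) is a cell NEW ESTIMATE, NOT PRINTED in [I] = [Balaban1987RG1] (CMP **109**),
[II] = [Balaban1988RG2Cluster] (CMP **116**), [B9] = [Balaban1985Propagators2] (CMP **99**), and NOT PROVED for Bałaban's E^{(j)}
(«NE9 ⇐ the named binders»; 0∕18 leaves instantiated on Bałaban's objects; spine PROVED 0∕9).  HONEST DEPENDENCY (cell line,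
verbatim): continuum YM on T⁴ ⇐ BetaPertH ∧ nine spine estimates (0/9 proved); BetaPertH ⇐ (D1) ∧ (D4) ∧ CAP+tail; G-an2-4 gates
asym, D1 and NE2/3/4.  `FlowStep.BetaPertH`, (B), (B^μ) do not occur.  Quotations are for TYPES only (ABSOLUTE RULE: nothing
printed in the audited series is asserted).  No `def`, no Prop-valued definition; bookkeeping over the ABSTRACT shapes of
`T4OutputRate` ∕ `T4HistoryLipschitzSegment`; 0 sorry.

WHY THIS FILE.  The END of record of row NE9 (`NE9SizeFedCouplingSpeciesReadOut.termSize_ne9_and_fadingMemory_species_margProj_fedA3`,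
p216114) concludes `TermSize Ef W κ N ∧ NE9 Ef W κ Λ ∧ FadingMemory …` for a functional `Ef : Functional (doubleCarriers C₀) E` whose
BACKGROUND SLOT `E` is a COMPLEX normed space (`[NormedSpace ℂ E]`), the old terms being read on the balls `ball (0:E) (R X)`
(`NE9Lemma1RemainderSpecies.analyticClass`; the (1.23)-pieces of [II] are Taylor remainders AT THE ORIGIN of `E` along the
slice curves ∕ directions: `NE9Lemma1RemainderPiece.dirRem H n A = taylorRem (τ ↦ H (τ • A)) n 1`).  So `E` is a CHART of the
complex small-field space CENTRED AT ONE CONFIGURATION — in Bałaban's words [B9] p. 399 *"configurations U′U …, U′ = e^{iηA}, where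
A is a sufficiently regular configuration with values in the complexified Lie algebra 𝔤ᶜ"* around the real configuration `U`, and
[I] (1.18) p. 263 *"defined and analytic on the space U^c_j(X, α₀, α₁)"* (a THIN complex neighbourhood of the real small-field
configurations, not a ball around one point).  The CONSUMER (node U3; NE5's functional of record `outB_KP S E₀ cB :
Functional R.carriers ↥R.admB`, `U3PolymerDictionaryNE9Face` ∕ `SubstrateSlotsOfRecord` §4) wants NE9 at EVERY real admissible
background `U : ↥R.admB`.  The g30 sheet (`CPLX-SLOT-NE9-g30.md` §3 (iv)) wrote the real row as ONE pull-back `NE9ComplexEncoding.ne9_comap`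
along «`U ↦` the 𝔤-coordinates of `U` relative to `uB V`» — that needs ONE chart containing ALL real backgrounds and a
LOGARITHM `↥R.admB → E` (Mathlib has no matrix logarithm; and no single ball of analyticity contains 𝔘_j).  THE CORRECT READING
(this file, located self-correction O-ne9p1g31-1 of the g30 (iv) sentence — nothing landed is affected): ONE CHART PER REAL
BACKGROUND `U`, centred at `U` (chart types `Ec U`, possibly all the same ambient type), the END applied chart by chart with
background-UNIFORM letters `κ, N, Λ`, and the real functional READ AT THE CENTRE `pt U` (= `0`) of its own chart on the `re` copy
of the doubled carriers: `E g U X = Ef U g (pt U) (X, re)`.  Then `NE9 E W κ Λ` (§1–§2) — a two-line triangle-free bookkeeping,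
but it is what makes the substrate's D-8 chart item (iii) CHEAP: no logarithm, no surjectivity of `exp`, no global chart is ever
needed; the chart map only has to send `0 ↦` (the transporter data of) `U` and be holomorphic near `0`.
* §1 `ne9_of_chartFamily`, `termSize_of_chartFamily`, `decayBound_of_chartFamily` (+ the conjunction) — pull-back of the three
  shapes along a chart family `(Ec U, Ef U, pt U)_U` over a scale- and d-preserving map of domains `f`;
* §2 `…_re` versions: `C′ := doubleCarriers C`, `f X := (X, re)` — the real functional is the real part at the centre;
* §3 non-vacuity: a family of history-independent complex functionals gives the real row with `Λ ≡ 0`.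
DISGUISE TEST: no estimate; the hypotheses `h : ∀ U, NE9 (Ef U) W κ Λ` are NE9 ITSELF chart by chart (to be produced by the END of
record per chart); this file only relocates the background quantifier.  NOT PRINTED and not claimed: that Bałaban's terms satisfy
the END's binders on any chart (O-NE9-1 = substrate S-U3 WITH D-6 AND D-8).

References (TYPES ∕ loci only): [Balaban1987RG1] T. Bałaban, CMP **109** (1987) 249–301, (1.11)–(1.18) pp. 262–263;
[Balaban1988RG2Cluster] T. Bałaban, CMP **116** (1988) 1–22, (1.23)–(1.24) p. 7; [Balaban1985Propagators2] T. Bałaban, CMP **99**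
(1985) 389–434, Sect. B pp. 399–400, Thm 3.4.  Summits-side NEW work (LEAN PLACEMENT RULE); imports `T4HistoryLipschitzSegment`
(shape `TermSize`) and `NE9ComplexEncoding` (`doubleCarriers`) BY NAME; modifies nothing.  Value = bookkeeping, NOT summit progress.
-/

noncomputable section

namespace Summit.QuantumFields.BalabanUV.T4Continuum.NE9ChartFamilyPullback

open scoped BigOperators
open Literature.MathematicalPhysics.QuantumFieldTheory.Balaban1983to89
open Literature.MathematicalPhysics.QuantumFieldTheory.Balaban1983to89.T4OutputRate
open Literature.MathematicalPhysics.QuantumFieldTheory.Balaban1983to89.T4HistoryLipschitzSegment (TermSize)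
open Summit.QuantumFields.BalabanUV.T4Continuum.NE9ComplexEncoding (doubleCarriers reIm ne9_reIm_of_const)

variable {C C' : Carriers} {Bg : Type} {Ec : Bg → Type}

/-! ## §1 Pull-back of `NE9` ∕ `TermSize` ∕ `DecayBound` along a chart FAMILY read at base points -/

/-- **NE9 PULLS BACK ALONG A CHART FAMILY.**  For every real background `U : Bg` let `Ef U` be a functional on carriers `C′`
with (complex-chart) background type `Ec U`, satisfying NE9 with the SAME `W, κ, Λ`; if the real functional is read at a base
point of its own chart, `E g U X = Ef U g (pt U) (f X)`, along a map of domains `f` preserving creation step and tree length,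
then `E` satisfies NE9 with `κ, Λ` (one chart per background; `NE9ComplexEncoding.ne9_comap` is the one-chart case
`Ec U := Bg′`, `Ef U := E′`, `pt := φ`). [cite: Balaban1987RG1, (1.18) p.263; Balaban1985Propagators2, Sect. B p.399] -/
theorem ne9_of_chartFamily {E : Functional C Bg} (Ef : ∀ U : Bg, Functional C' (Ec U)) {W : Set (ℕ → ℝ)} {κ : ℝ}
    {Λ : ℕ → ℕ → ℝ} (f : C.Dom → C'.Dom) (pt : ∀ U : Bg, Ec U)
    (hscale : ∀ X, C'.scale (f X) = C.scale X) (hd : ∀ X, C'.d (f X) = C.d X)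
    (hE : ∀ g (U : Bg) (X : C.Dom), E g U X = Ef U g (pt U) (f X)) (h : ∀ U, NE9 (Ef U) W κ Λ) : NE9 E W κ Λ := by
  intro g hg g' hg' U X
  have h1 := h U g hg g' hg' (pt U) (f X)
  rw [hscale X, hd X] at h1
  rwa [hE g U X, hE g' U X]

/-- **`TermSize` PULLS BACK ALONG A CHART FAMILY** (same reading; the size profile `N` and the rate `κ` are background-uniform).
[cite: Balaban1987RG1, (1.18) p.263] -/
theorem termSize_of_chartFamily {E : Functional C Bg} (Ef : ∀ U : Bg, Functional C' (Ec U)) {W : Set (ℕ → ℝ)} {κ : ℝ}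
    {N : ℕ → ℝ} (f : C.Dom → C'.Dom) (pt : ∀ U : Bg, Ec U)
    (hscale : ∀ X, C'.scale (f X) = C.scale X) (hd : ∀ X, C'.d (f X) = C.d X)
    (hE : ∀ g (U : Bg) (X : C.Dom), E g U X = Ef U g (pt U) (f X)) (h : ∀ U, TermSize (Ef U) W κ N) :
    TermSize E W κ N := by
  intro g hg U X
  have h1 := h U g hg (pt U) (f X)
  rw [hscale X, hd X] at h1
  rwa [hE g U X]

/-- **`DecayBound` PULLS BACK ALONG A CHART FAMILY** (the printed form (0.25) ∕ (1.18), one constant `E₀`).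
[cite: Balaban1987RG1, (0.25) p.257, (1.18) p.263] -/
theorem decayBound_of_chartFamily {E : Functional C Bg} (Ef : ∀ U : Bg, Functional C' (Ec U)) {W : Set (ℕ → ℝ)}
    {E₀ κ : ℝ} (f : C.Dom → C'.Dom) (pt : ∀ U : Bg, Ec U) (hd : ∀ X, C'.d (f X) = C.d X)
    (hE : ∀ g (U : Bg) (X : C.Dom), E g U X = Ef U g (pt U) (f X)) (h : ∀ U, DecayBound (Ef U) W E₀ κ) :
    DecayBound E W E₀ κ := by
  intro g hg U X
  have h1 := h U g hg (pt U) (f X)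
  rw [hd X] at h1
  rwa [hE g U X]

/-- **THE END's CONJUNCTION PULLS BACK ALONG A CHART FAMILY**: `TermSize ∧ NE9` chart by chart (the END of record's first two
conjuncts, its third `FadingMemory C₉ ω Λ` does not mention the background) give `TermSize ∧ NE9` for the real functional read at
the centres. [cite: Balaban1987RG1, (1.18) p.263] -/
theorem termSize_ne9_of_chartFamily {E : Functional C Bg} (Ef : ∀ U : Bg, Functional C' (Ec U)) {W : Set (ℕ → ℝ)} {κ : ℝ}
    {N : ℕ → ℝ} {Λ : ℕ → ℕ → ℝ} (f : C.Dom → C'.Dom) (pt : ∀ U : Bg, Ec U)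
    (hscale : ∀ X, C'.scale (f X) = C.scale X) (hd : ∀ X, C'.d (f X) = C.d X)
    (hE : ∀ g (U : Bg) (X : C.Dom), E g U X = Ef U g (pt U) (f X))
    (h : ∀ U, TermSize (Ef U) W κ N ∧ NE9 (Ef U) W κ Λ) : TermSize E W κ N ∧ NE9 E W κ Λ :=
  ⟨termSize_of_chartFamily Ef f pt hscale hd hE fun U => (h U).1,
    ne9_of_chartFamily Ef f pt hscale hd hE fun U => (h U).2⟩

/-! ## §2 The complex-chart reading: doubled carriers, the real functional = the real part at the chart centre -/

/-- **THE REAL ROW FROM COMPLEX CHARTS (NE9).**  Charts `Ec U` (one per real background `U`), doubled-carrier functionals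
`Ef U : Functional (doubleCarriers C) (Ec U)` — the `re`∕`im` copies of the complex terms on the chart (`NE9ComplexEncoding`) —
each satisfying NE9 with the same letters (the END of record applied chart by chart), and the real functional read as the REAL
PART AT THE CENTRE: `E g U X = Ef U g (pt U) (X, re)`.  Then `NE9 E W κ Λ`.  This is the consumer's reading of record for
«NE9 for Bałaban's E^{(j)}» (WALL-NE9-P1 §3 (vi)): no logarithm `↥R.admB → E`, no global chart.
[cite: Balaban1987RG1, (1.18) p.263; Balaban1988RG2Cluster, (1.23)-(1.24) p.7] -/
theorem ne9_re_of_chartFamily {E : Functional C Bg} (Ef : ∀ U : Bg, Functional (doubleCarriers C) (Ec U))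
    {W : Set (ℕ → ℝ)} {κ : ℝ} {Λ : ℕ → ℕ → ℝ} (pt : ∀ U : Bg, Ec U)
    (hE : ∀ g (U : Bg) (X : C.Dom), E g U X = Ef U g (pt U) (X, true)) (h : ∀ U, NE9 (Ef U) W κ Λ) : NE9 E W κ Λ :=
  ne9_of_chartFamily (C' := doubleCarriers C) Ef (fun X => (X, true)) pt (fun _ => rfl) (fun _ => rfl) hE h

/-- **THE REAL ROW FROM COMPLEX CHARTS (`TermSize ∧ NE9`).** [cite: Balaban1987RG1, (1.18) p.263] -/
theorem termSize_ne9_re_of_chartFamily {E : Functional C Bg} (Ef : ∀ U : Bg, Functional (doubleCarriers C) (Ec U))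
    {W : Set (ℕ → ℝ)} {κ : ℝ} {N : ℕ → ℝ} {Λ : ℕ → ℕ → ℝ} (pt : ∀ U : Bg, Ec U)
    (hE : ∀ g (U : Bg) (X : C.Dom), E g U X = Ef U g (pt U) (X, true))
    (h : ∀ U, TermSize (Ef U) W κ N ∧ NE9 (Ef U) W κ Λ) : TermSize E W κ N ∧ NE9 E W κ Λ :=
  termSize_ne9_of_chartFamily (C' := doubleCarriers C) Ef (fun X => (X, true)) pt (fun _ => rfl) (fun _ => rfl) hE h

/-- The same with the END's THIRD conjunct carried along (it is background-free): from `∀ U, TermSize ∧ NE9 ∧ FadingMemory` on the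
charts and ONE background `U₀` (to read the fading clause somewhere) the real row `TermSize ∧ NE9 ∧ FadingMemory`. [folklore] -/
theorem termSize_ne9_fading_re_of_chartFamily {E : Functional C Bg} (Ef : ∀ U : Bg, Functional (doubleCarriers C) (Ec U))
    {W : Set (ℕ → ℝ)} {κ C₉ ω : ℝ} {N : ℕ → ℝ} {Λ : ℕ → ℕ → ℝ} (pt : ∀ U : Bg, Ec U) (U₀ : Bg)
    (hE : ∀ g (U : Bg) (X : C.Dom), E g U X = Ef U g (pt U) (X, true))
    (h : ∀ U, TermSize (Ef U) W κ N ∧ NE9 (Ef U) W κ Λ ∧ FadingMemory C₉ ω Λ) :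
    TermSize E W κ N ∧ NE9 E W κ Λ ∧ FadingMemory C₉ ω Λ :=
  have h2 := termSize_ne9_re_of_chartFamily Ef pt hE fun U => ⟨(h U).1, (h U).2.1⟩
  ⟨h2.1, h2.2, (h U₀).2.2⟩

/-! ## §3 Non-vacuity -/

/-- NON-VACUITY ∕ SANITY: for a family of HISTORY-INDEPENDENT complex functionals on the charts the real functional read at the
centres satisfies NE9 with `Λ ≡ 0` (via `NE9ComplexEncoding.ne9_reIm_of_const` chart by chart). [folklore] -/
theorem ne9_re_of_chartFamily_const (F₀ : ∀ U : Bg, Ec U → C.Dom → ℂ) (pt : ∀ U : Bg, Ec U) (W : Set (ℕ → ℝ)) (κ : ℝ) :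
    NE9 (C := C) (fun _ U X => (F₀ U (pt U) X).re) W κ (fun _ _ => 0) :=
  ne9_re_of_chartFamily (fun U => reIm (C := C) fun _ => F₀ U) pt (fun _ _ _ => rfl)
    fun U => ne9_reIm_of_const (F₀ U) W κ

end Summit.QuantumFields.BalabanUV.T4Continuum.NE9ChartFamilyPullback

end
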